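import Mathlib
import HarnessLib
import Literature.NumberTheory.LFunctions.RHWave0PNTProofs
import Summits.Parity.GeneralizedHardyLittlewood.Theses.PolynomialKatai

/-!
# `PrimeMultiplierChowla` is false without the guard `Δ ≠ 0` (negative lemma for stmt-Parity-18777)

Load-bearing analysis of the crux
`Summit.Parity.GeneralizedHardyLittlewood.Theses.PolynomialKatai.PrimeMultiplierChowla` ("the door"
of route PolynomialKatai). The type negated by `primeMultiplierChowla_false_without_shiftNonzero`
below is that statement with the single hypothesis `Δ ≠ 0` deleted and NOTHING else changed (same
binders, same window `X^δ ≤ P ≤ X^{1/4}`, same normalisation `ε X / log P`); it is FALSE. (It is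
spelled out inline rather than as a `def … : Prop`, since only registered obligations may define
propositions under `Summits/`.)

Witness: `L = 1, ε = 1/100, δ = 1/8, X = P⁴, a = 1, k = 1, Δ = 0, e ≡ 0, lo ≡ 1, hi ≡ P³` with `P`
large. Every summand is then `λ(u)·λ(pu) = -λ(u)² = -1` (complete multiplicativity, `λ(p) = -1`),
each inner sum equals `-P³`, and the left side is `#{p prime ∈ (P, 2P]} · P³ ≥ P⁴ / (4 log P)` —
the dyadic prime count comes from the prime number theorem `θ(x) ~ x` (tree theorem
`Literature.NumberTheory.LFunctions.chebyshevTheta_isEquivalent`, Wiener–Ikehara) at `2P` together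
with Chebyshev's bound `θ(P) ≤ P log 4` (Mathlib `Chebyshev.theta_le_log4_mul_x`) — against the
right side `P⁴ / (100 log P)`.

Reading: any proof of the door must use `Δ ≠ 0`; equivalently the trivial bound `≍ X / log P` of
the door is attained at `Δ = 0`, which certifies that the normalisation `ε · X / log P` asks for a
genuine `o(1)` saving (refuter crux-attack at birth, 2026-08-17). [folklore]
-/

namespace Summit.Parity.GeneralizedHardyLittlewood.Theorems.PrimeMultiplierChowlaNegative

open Filter

/-- The `Δ = 0` summand: `λ(u)·λ(pu) = -1` for `u ≠ 0`, `p` prime (complete multiplicativity,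
`λ(p) = -1`, `λ(u)² = 1`). [folklore] -/
theorem pmc_liouville_mul_liouville_prime_mul {p u : ℕ} (hp : p.Prime) (hu : u ≠ 0) :
    ArithmeticFunction.liouville u * ArithmeticFunction.liouville (p * u) = -1 := by
  have hsq : ArithmeticFunction.liouville u * ArithmeticFunction.liouville u = 1 := by
    rw [ArithmeticFunction.liouville_apply hu, ← pow_add, ← two_mul, pow_mul]
    norm_num
  have hprime : ArithmeticFunction.liouville p = -1 := by
    rw [ArithmeticFunction.liouville_apply hp.ne_zero, ArithmeticFunction.cardFactors_apply_prime hp,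
      pow_one]
  rw [ArithmeticFunction.liouville_apply_mul, hprime, neg_one_mul, mul_neg, hsq]

/-- The inner sum of the door at `a = 1, k = 1, Δ = 0, e = 0, [lo, hi] = [1, H]` equals `-H`.
[folklore] -/
theorem pmc_inner_sum_shift_zero {p : ℕ} (hp : p.Prime) (H : ℕ) :
    (∑ u ∈ (Finset.Icc 1 H).filter (fun u : ℕ => u ≡ 0 [MOD 1]),
        ((ArithmeticFunction.liouville u : ℤ) : ℝ) *
          ((ArithmeticFunction.liouville (Int.toNat (((1 : ℤ) * p * u : ℤ) + 0)) : ℤ) : ℝ)) =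
      -(H : ℝ) := by
  rw [Finset.filter_eq_self.mpr (fun u _ => Nat.modEq_one)]
  calc (∑ u ∈ Finset.Icc 1 H,
        ((ArithmeticFunction.liouville u : ℤ) : ℝ) *
          ((ArithmeticFunction.liouville (Int.toNat (((1 : ℤ) * p * u : ℤ) + 0)) : ℤ) : ℝ))
        = ∑ u ∈ Finset.Icc 1 H, (-1 : ℝ) := by
          refine Finset.sum_congr rfl (fun u hu => ?_)
          have hu1 : u ≠ 0 := by have := (Finset.mem_Icc.mp hu).1; omega
          have hcast : (((1 : ℤ) * p * u : ℤ) + 0).toNat = p * u := by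
            have : (((1 : ℤ) * p * u : ℤ) + 0) = ((p * u : ℕ) : ℤ) := by push_cast; ring
            rw [this, Int.toNat_natCast]
          rw [hcast, ← Int.cast_mul, pmc_liouville_mul_liouville_prime_mul hp hu1]
          norm_num
    _ = -(H : ℝ) := by simp

/-- Dyadic prime count from `θ(x) ~ x` (used at `2P`) and `θ(P) ≤ P log 4`:
`P ≤ #{p prime ∈ (P, 2P]} · 4 log P` once `θ(t) ≥ (19/20) t` for `t ≥ T₀`, `P ≥ max(T₀, 16)`.
[folklore] -/
theorem pmc_card_primes_Ioc_ge {P : ℕ} {T₀ : ℝ}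
    (hT₀ : ∀ t : ℝ, T₀ ≤ t → (1 - 1 / 20) * t ≤ Chebyshev.theta t)
    (hPT : T₀ ≤ (P : ℝ)) (hP16 : (16 : ℝ) ≤ (P : ℝ)) :
    (P : ℝ) ≤ (((Finset.Ioc P (2 * P)).filter Nat.Prime).card : ℝ) * (4 * Real.log (P : ℝ)) := by
  have hP0 : (0 : ℝ) < P := by linarith
  have hlogP : Real.log 2 ≤ Real.log P := Real.log_le_log (by norm_num) (by linarith)
  have hfloor2 : ⌊(2 * (P : ℝ))⌋₊ = 2 * P := by
    rw [show (2 * (P : ℝ)) = ((2 * P : ℕ) : ℝ) by push_cast; ring, Nat.floor_natCast]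
  -- the block sum of `log p` over primes in `(P, 2P]` is `θ(2P) - θ(P)`
  have hsplit : Chebyshev.theta (2 * (P : ℝ)) - Chebyshev.theta (P : ℝ) =
      ∑ p ∈ (Finset.Ioc P (2 * P)).filter Nat.Prime, Real.log (p : ℝ) := by
    simp only [Chebyshev.theta, Nat.floor_natCast, hfloor2, Finset.sum_filter]
    rw [← Finset.sum_Ioc_consecutive _ (Nat.zero_le P) (by omega : P ≤ 2 * P), add_sub_cancel_left]
  -- each `log p ≤ log (2P) ≤ 2 log P`
  have hlog2P : Real.log (2 * (P : ℝ)) ≤ 2 * Real.log P := by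
    rw [Real.log_mul (by norm_num) hP0.ne', two_mul]
    linarith
  have hcard0 : (0 : ℝ) ≤ (((Finset.Ioc P (2 * P)).filter Nat.Prime).card : ℝ) := Nat.cast_nonneg _
  have hblock : ∑ p ∈ (Finset.Ioc P (2 * P)).filter Nat.Prime, Real.log (p : ℝ) ≤
      (((Finset.Ioc P (2 * P)).filter Nat.Prime).card : ℝ) * (2 * Real.log P) := by
    have h := Finset.sum_le_card_nsmul ((Finset.Ioc P (2 * P)).filter Nat.Prime)
      (fun p : ℕ => Real.log (p : ℝ)) (2 * Real.log P) (fun p hp => by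
        have hp2 : p ≤ 2 * P := (Finset.mem_Ioc.mp (Finset.mem_filter.mp hp).1).2
        have hppos : (0 : ℝ) < p := by exact_mod_cast (Finset.mem_filter.mp hp).2.pos
        have hp2' : (p : ℝ) ≤ 2 * (P : ℝ) := by exact_mod_cast hp2
        exact (Real.log_le_log hppos hp2').trans hlog2P)
    rwa [nsmul_eq_mul] at h
  -- PNT lower bound at `2P`, Chebyshev upper bound at `P`
  have hlow2P : (1 - 1 / 20) * (2 * (P : ℝ)) ≤ Chebyshev.theta (2 * (P : ℝ)) := hT₀ _ (by linarith)
  have hlog4 : Real.log 4 < 1.3863 := by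
    have h4 : Real.log 4 = 2 * Real.log 2 := by
      rw [show (4 : ℝ) = 2 ^ 2 by norm_num, Real.log_pow]; norm_num
    rw [h4]; have := Real.log_two_lt_d9; linarith
  have hupP : Chebyshev.theta (P : ℝ) ≤ 1.3863 * P :=
    (Chebyshev.theta_le_log4_mul_x hP0.le).trans (mul_le_mul_of_nonneg_right hlog4.le hP0.le)
  have hdiff : (P : ℝ) / 2 ≤ ∑ p ∈ (Finset.Ioc P (2 * P)).filter Nat.Prime, Real.log (p : ℝ) := by
    rw [← hsplit]; linarith
  calc (P : ℝ) = 2 * ((P : ℝ) / 2) := by ring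
    _ ≤ 2 * ((((Finset.Ioc P (2 * P)).filter Nat.Prime).card : ℝ) * (2 * Real.log P)) := by
        gcongr; exact hdiff.trans hblock
    _ = _ := by ring

/-- NEGATIVE LEMMA (load-bearing hypothesis of stmt-Parity-18777): the door
`PolynomialKatai.PrimeMultiplierChowla` with its guard `Δ ≠ 0` dropped — the negated type below is
the door verbatim except that `Δ ≠ 0 →` is deleted — is false: at `Δ = 0` every summand is `-1` and
the prime multipliers in `(P, 2P]` (≫ P/log P of them, PNT) add up to `≥ P⁴/(4 log P) >
P⁴/(100 log P)`. [folklore] -/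
theorem primeMultiplierChowla_false_without_shiftNonzero :
    ¬ (∀ L : ℕ, 1 ≤ L → ∀ ε : ℝ, 0 < ε → ∀ δ : ℝ, 0 < δ → ∃ X₀ : ℕ, ∀ X : ℕ, X₀ ≤ X → ∀ P : ℕ,
      (X : ℝ) ^ δ ≤ (P : ℝ) → (P : ℝ) ≤ (X : ℝ) ^ (1 / 4 : ℝ) → ∀ a : ℤ, a ≠ 0 → |a| ≤ (L : ℤ) →
      ∀ k : ℕ, 1 ≤ k → k ≤ L → ∀ Δ : ℤ, |Δ| ≤ (L : ℤ) * (X : ℤ) → ∀ e lo hi : ℕ → ℕ,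
      (∀ p : ℕ, hi p * P ≤ L * X) →
      (∑ p ∈ (Finset.Ioc P (2 * P)).filter Nat.Prime,
        |∑ u ∈ (Finset.Icc (lo p) (hi p)).filter (fun u : ℕ => u ≡ e p [MOD k]),
          ((ArithmeticFunction.liouville u : ℤ) : ℝ) *
            ((ArithmeticFunction.liouville (Int.toNat ((a * p * u : ℤ) + Δ)) : ℤ) : ℝ)|) ≤
        ε * (X : ℝ) / Real.log (P : ℝ)) := by
  intro h
  -- PNT: `θ(t) ≥ (19/20) t` for all large `t`
  have hθev : ∀ᶠ t : ℝ in atTop, (1 - 1 / 20) * t ≤ Chebyshev.theta t := by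
    have hb := (Literature.NumberTheory.LFunctions.chebyshevTheta_isEquivalent).isLittleO.bound
      (show (0 : ℝ) < 1 / 20 by norm_num)
    filter_upwards [hb, eventually_ge_atTop 0] with t ht ht0
    simp only [Pi.sub_apply, Real.norm_eq_abs, abs_of_nonneg ht0] at ht
    have := (abs_le.mp ht).1
    linarith
  obtain ⟨T₀, hT₀⟩ := Filter.eventually_atTop.mp hθev
  obtain ⟨X₀, hX₀⟩ := h 1 le_rfl (1 / 100) (by norm_num) (1 / 8) (by norm_num)
  -- the witness scale `P ≥ max (X₀, T₀, 16)`, `X = P⁴`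
  obtain ⟨P, hP⟩ : ∃ P : ℕ, max (X₀ : ℝ) (max T₀ 16) ≤ P := exists_nat_ge _
  have hPX₀ : (X₀ : ℝ) ≤ P := le_trans (le_max_left _ _) hP
  have hPT₀ : T₀ ≤ (P : ℝ) := le_trans ((le_max_left _ _).trans (le_max_right _ _)) hP
  have hP16 : (16 : ℝ) ≤ P := le_trans ((le_max_right _ _).trans (le_max_right _ _)) hP
  have hP1 : (1 : ℝ) ≤ P := by linarith
  have hPpos : (0 : ℝ) < P := by linarith
  have hXX₀ : X₀ ≤ P ^ 4 := by
    have h1 : X₀ ≤ P := by exact_mod_cast hPX₀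
    exact h1.trans (Nat.le_self_pow (by norm_num) P)
  have hwin1 : ((P ^ 4 : ℕ) : ℝ) ^ (1 / 8 : ℝ) ≤ (P : ℝ) := by
    push_cast
    rw [← Real.rpow_natCast_mul hPpos.le]
    refine (Real.rpow_le_rpow_of_exponent_le hP1 ?_).trans (le_of_eq (Real.rpow_one _))
    norm_num
  have hwin2 : (P : ℝ) ≤ ((P ^ 4 : ℕ) : ℝ) ^ (1 / 4 : ℝ) := by
    push_cast
    rw [← Real.rpow_natCast_mul hPpos.le]
    norm_num
  have key := hX₀ (P ^ 4) hXX₀ P hwin1 hwin2 1 one_ne_zero (by simp) 1 le_rfl le_rfl 0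
    (by rw [abs_zero]; positivity) (fun _ => 0) (fun _ => 1) (fun _ => P ^ 3)
    (fun p => by show P ^ 3 * P ≤ 1 * P ^ 4; rw [one_mul, ← pow_succ])
  -- every inner sum is `-P³`
  have hinner : ∀ p ∈ (Finset.Ioc P (2 * P)).filter Nat.Prime,
      |∑ u ∈ (Finset.Icc 1 (P ^ 3)).filter (fun u : ℕ => u ≡ 0 [MOD 1]),
        ((ArithmeticFunction.liouville u : ℤ) : ℝ) *
          ((ArithmeticFunction.liouville (Int.toNat (((1 : ℤ) * p * u : ℤ) + 0)) : ℤ) : ℝ)| =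
        (P : ℝ) ^ 3 := by
    intro p hp
    rw [pmc_inner_sum_shift_zero (Finset.mem_filter.mp hp).2 (P ^ 3), abs_neg, Nat.cast_pow,
      abs_of_nonneg (by positivity)]
  have hLHS : (((Finset.Ioc P (2 * P)).filter Nat.Prime).card : ℝ) * (P : ℝ) ^ 3 ≤
      1 / 100 * ((P ^ 4 : ℕ) : ℝ) / Real.log (P : ℝ) :=
    calc (((Finset.Ioc P (2 * P)).filter Nat.Prime).card : ℝ) * (P : ℝ) ^ 3
          = ∑ p ∈ (Finset.Ioc P (2 * P)).filter Nat.Prime, (P : ℝ) ^ 3 := by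
            rw [Finset.sum_const, nsmul_eq_mul]
      _ = ∑ p ∈ (Finset.Ioc P (2 * P)).filter Nat.Prime,
            |∑ u ∈ (Finset.Icc 1 (P ^ 3)).filter (fun u : ℕ => u ≡ 0 [MOD 1]),
              ((ArithmeticFunction.liouville u : ℤ) : ℝ) *
                ((ArithmeticFunction.liouville (Int.toNat (((1 : ℤ) * p * u : ℤ) + 0)) : ℤ) : ℝ)| :=
            (Finset.sum_congr rfl hinner).symm
      _ ≤ 1 / 100 * ((P ^ 4 : ℕ) : ℝ) / Real.log (P : ℝ) := key
  -- compare with the dyadic prime count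
  have hlogpos : 0 < Real.log (P : ℝ) := Real.log_pos (by linarith)
  have hcard := pmc_card_primes_Ioc_ge hT₀ hPT₀ hP16
  have h2 : (((Finset.Ioc P (2 * P)).filter Nat.Prime).card : ℝ) * (P : ℝ) ^ 3 * Real.log P ≤
      (P : ℝ) ^ 4 / 100 := by
    have h := hLHS
    rw [le_div_iff₀ hlogpos] at h
    push_cast at h
    linarith
  have hP3 : (0 : ℝ) ≤ (P : ℝ) ^ 3 := by positivity
  have h3 : (P : ℝ) ^ 4 ≤ 4 * ((P : ℝ) ^ 4 / 100) :=
    calc (P : ℝ) ^ 4 = (P : ℝ) * (P : ℝ) ^ 3 := by ring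
      _ ≤ ((((Finset.Ioc P (2 * P)).filter Nat.Prime).card : ℝ) * (4 * Real.log (P : ℝ))) *
            (P : ℝ) ^ 3 := mul_le_mul_of_nonneg_right hcard hP3
      _ = 4 * ((((Finset.Ioc P (2 * P)).filter Nat.Prime).card : ℝ) * (P : ℝ) ^ 3 *
            Real.log P) := by ring
      _ ≤ 4 * ((P : ℝ) ^ 4 / 100) := by linarith [h2]
  have hP4 : (0 : ℝ) < (P : ℝ) ^ 4 := by positivity
  linarith

end Summit.Parity.GeneralizedHardyLittlewood.Theorems.PrimeMultiplierChowlaNegative
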